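import Summits.Ventures.AbcSig.Rows.Bridge
import Summits.Ventures.AbcSig.Rows.C2aL397A0
import Summits.Ventures.AbcSig.Rows.C2aL397A0AB

/-!
# Venture AbcSig — CELL `C2aL397A0`: the census statement `Rows.C2aCellRed 397 (fun a => a = 0) {11}` from the two row theorems

HONEST FRAMING. COMPUTATION cell `pub-abcsig`; CONDITIONAL theorem; no claim on ABC or any summit. Hypotheses exactly as in
`Rows/C2aL397A0.lean` and `Rows/C2aL397A0AB.lean`: `BS04Package` (CITED), `DataComplete` / `RefinesCPSymAll` (COMPUTED, certified level files;
norm-form certificates), and the rows' per-orbit CITED exclusions universally quantified in the exponent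
(shared by both distributions (a = 0: the second is the first with x, y swapped)). Conclusion = p1's census predicate (`Rows/Statements.lean`) with the residual of the row of
record `census/rows/C2a/C2a-l397-a0.md` (sha16 `e87e1368708fce10`): all four coprime distributions `A·B = 2^0·397^m`, reduced exponents.
GENERATED by p-lean g4 `gen4/c2arow2.py` (pattern of `Rows/C2aL277A0XCell.lean`).
-/

namespace Summit.Ventures.AbcSig

/-- Cell `C2aL397A0`: `Rows.C2aCellRed 397 (fun a => a = 0) {11}` under the rows' hypotheses. -/
theorem xcell_C2aL397A0 (M : NewformModel) (hP : M.BS04Package)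
    (hD12704 : M.DataComplete 12704 level12704Orbits) (hCP12704 : M.RefinesCPSymAll 12704 level12704CP)
    (hD794 : M.DataComplete 794 level794Orbits) (hCP794 : M.RefinesCPSymAll 794 level794CP)
    (hX_orbit_12704_15 : ∀ n m : ℕ, n ∈ ([109] : List ℕ) → M.Excludes 12704 orbit_12704_15 (famB (2 ^ 0 * 397 ^ m) n (fun _ _ => True)))
    (hX_orbit_794_8 : ∀ n m : ℕ, n ∈ ([199] : List ℕ) → M.Excludes 794 orbit_794_8 (famB (2 ^ 0 * 397 ^ m) n (fun _ _ => True))) :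
    Rows.C2aCellRed 397 (fun a => a = 0) {11} :=
  C2aCellRed_of_rows 397 (by norm_num) (by norm_num) _ _
    (fun n hn h11 hnℓ hR a m (ha : a = 0) han hm hmn x y z h1 h2 => by
      subst ha
      exact xrow_C2aL397A0 M hP  hD12704 hCP12704 hD794 hCP794 n hn h11 hnℓ (by simpa using hR) m hm hmn (hX_orbit_12704_15 n m) (hX_orbit_794_8 n m) x y z h1 h2)
    (fun n hn h11 hnℓ hR a m (ha : a = 0) han hm hmn x y z h1 h2 => by
      subst ha
      exact xrow_C2aL397A0AB M hP  hD12704 hCP12704 hD794 hCP794 n hn h11 hnℓ (by simpa using hR) m hm hmn (hX_orbit_12704_15 n m) (hX_orbit_794_8 n m) x y z h1 h2)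

end Summit.Ventures.AbcSig
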